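/-
Origin: expansion seat `planner-pub-hodgecm-toy2-g8-0`, handover #3 2026-08-18T15:21:32Z (`HOME/pub-hodgecm-toy2-g8/lean/Toy2g8/HsGen.lean`, md5 dc38466a, 276 lines);
landed by the gen-8 packager in gate run 31 as `HodgeCM/Model/Toy/HsGen.lean` (import ^import Toy2g8\.SubHS[ \t]*$→import HodgeCM.Model.Toy.SubHS ×1; import ^import Toy2g8\.Contr[ \t]*$→import HodgeCM.Model.Toy.Contr ×1).
-/
/-
Origin: CONSISTENCY seat 2 gen 8 `planner-pub-hodgecm-toy2-g8-0` (unit `pub-hodgecm-toy2-g8`), WIP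
`HOME/pub-hodgecm-toy2-g8/lean/Toy2g8/HsGen.lean`; intended target `HodgeCM/Model/Toy/HsGen.lean` (new leaf).
-/
import Mathlib
import Summits.HodgeConjecture.HodgeCM.Model.Toy.InertAtom
import Summits.HodgeConjecture.HodgeCM.Model.Toy.SubHS
import Summits.HodgeConjecture.HodgeCM.Model.Toy.Contr

/-!
# Generators of the sub-Hodge-structure family on generation-2 toy objects

Toy-side plumbing for the F4 row of the load-bearing census of `COR_CM_of_descentFactsB₄` WITH `hR` and F7d-B
(`HodgeCM.Model.Toy.HsMod`).  For a generation-2 object `X : Obj₂` (an expansion of CM atoms and Picard blocks):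
* `Obj₂.leafSpan X T` — the lattice span `L_T ≤ H¹(X)` of a set `T` of leaves; it is a sub-Hodge structure
  (`isSubHS_leafSpan`), all leaves span `H¹(X)` (`leafSpan_univ`), and `(N_atoms, blocks)` has cost `≤ 2 dim X`
  (`cost_atoms_blocks`);
* `Obj₂.hsGen X c l` — **the generators**: the span of the pure-wedge spaces `⋀ˡ(N ⊔ L_T)` (`BlockGysin.extPow`,
  `HodgeCM.Model.Toy.Contr`) over the rational SUB-HODGE STRUCTURES `N ≤ H¹(X)` (`Obj.IsSubHS`,
  `HodgeCM.Model.Toy.SubHS`) and the sets `T` of Picard-block leaves with cost `rk N + 4·#T ≤ c`;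
* `hsGen_map_le` / `top_map_le_hsGen` — pull-back along a morphism `f : X ⟶ Y` (block-admissible `f^*`) maps
  `hsGen Y c l` into `hsGen X c l` (images of sub-HS are sub-HS, a block leaf goes to `0` or isomorphically onto a
  block leaf: `admTgt`), and all of `⋀ˡ H¹(Y)` into `hsGen X c l` once `2 dim Y ≤ c`;
* `map_contr_hsGen_le` — **descent under the block contraction** `contr k d ψ₁ ψ₂ τ`
  (`HodgeCM.Model.ToyG2.GysinMap`) for block-free `P` and Hodge `ψ₁ : H¹(P) → H¹(A)`, `ψ₂ : H¹(P) → H¹(B)`,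
  `rk H¹(B) ≤ d`: `hsGen P c (k + d) ↦ hsGen A (c - d) k` (rank bookkeeping of `HodgeCM.Model.Toy.Contr` plus:
  `ψ₁(N ∩ ker ψ₂)` is a sub-HS);
* `hsGen_cmObj₂_eq_bot` — **rigidity**: for a PRIMITIVE CM type of a Galois CM field `K` and `c < [K:ℚ]`, `0 < l`,
  `hsGen (A_{(K,Φ)}) c l = 0` (`H¹` is a simple Hodge structure: `IsSubHS.eq_bot_or_eq_top`; no blocks).
All proofs kernel-checked; nothing is cited.
-/

noncomputable section

open scoped TensorProduct

namespace HodgeCM.ToyG2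

open HodgeCM.Toy HodgeCM.Universe
open Literature.AlgebraicGeometry.Motives
open exteriorPower Module BlockGysin

/-! ### Leaf spans and the generators of the family -/

namespace Obj₂

variable (X : Obj₂)

/-- the lattice span `L_T ≤ H¹(X)` of a set `T` of leaves of `X` -/
def leafSpan (T : Finset X.s.toType) : Submodule ℚ X.L := ⨆ u ∈ T, LinearMap.range (X.inclAt u)

/-- **the generators of the sub-HS family** in degree `l` with cost budget `c`: the span of the pure-wedge spaces
`⋀ˡ(N ⊔ L_T)` over the rational sub-Hodge structures `N ≤ H¹(X)` and the sets `T` of Picard-block leaves with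
`rk N + 4·#T ≤ c`. -/
def hsGen (c l : ℕ) : Submodule ℚ (⋀[ℚ]^l X.L) :=
  ⨆ (N : Submodule ℚ X.L) (T : Finset X.s.toType)
    (_ : X.toObj.IsSubHS N ∧ (∀ u ∈ T, (X.leaf u).IsPB) ∧ finrank ℚ N + 4 * T.card ≤ c),
    extPow (N ⊔ X.leafSpan T) l

variable {X}

/-- (Ported verbatim from the HodgeCMPerL package; no docstring in the source.) -/
theorem leafSpan_mono {T T' : Finset X.s.toType} (h : T ⊆ T') : X.leafSpan T ≤ X.leafSpan T' :=
  biSup_mono fun _ hu => h hu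

/-- a leaf span is a sub-Hodge structure -/
theorem isSubHS_leafSpan (T : Finset X.s.toType) : X.toObj.IsSubHS (X.leafSpan T) :=
  X.toObj.isSubHS_biSup T _ fun u _ =>
    X.toObj.isSubHS_range (⟨X.inclAt u, isHodge_inclAt X u⟩ : Obj.Hom X.toObj (X.leaf u).obj)

/-- the rank of a leaf span is at most the total rank of its leaves -/
theorem finrank_leafSpan_le (T : Finset X.s.toType) :
    finrank ℚ (X.leafSpan T) ≤ ∑ u ∈ T, finrank ℚ (X.leaf u).obj.L := by
  classical
  induction T using Finset.induction_on with
  | empty =>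
      have h0 : X.leafSpan ∅ = ⊥ := by simp [leafSpan]
      rw [Finset.sum_empty, h0, finrank_bot]
  | insert a T ha ih =>
      rw [Finset.sum_insert ha]
      unfold leafSpan at ih ⊢
      rw [Finset.iSup_insert]
      exact (Submodule.finrank_add_le_finrank_add_finrank _ _).trans
        (add_le_add (LinearMap.finrank_range_le _) ih)

/-- all the leaves span `H¹(X)` -/
theorem leafSpan_univ (X : Obj₂) : X.leafSpan Finset.univ = ⊤ := by
  have h0 : (X.leafSpan Finset.univ).mkQ = 0 :=
    eq_zero_of_comp_inclAt X _ fun u => LinearMap.ext fun x => by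
      rw [LinearMap.comp_apply, Submodule.mkQ_apply, LinearMap.zero_apply, Submodule.Quotient.mk_eq_zero]
      exact Submodule.mem_iSup_of_mem u (Submodule.mem_iSup_of_mem (Finset.mem_univ u) ⟨x, rfl⟩)
  rw [← Submodule.ker_mkQ (X.leafSpan Finset.univ), h0, LinearMap.ker_zero]

/-- (Ported verbatim from the HodgeCMPerL package; no docstring in the source.) -/
theorem pdim_of_isPB : ∀ {l : Leaf}, l.IsPB → l.pdim = 2
  | .atom _, h => h.elim
  | .pb _, _ => rfl

/-- `H¹(X) = N_atoms ⊔ L_blocks` -/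
theorem leafSpan_atoms_sup_blocks (X : Obj₂) :
    X.leafSpan (Finset.univ.filter fun u => ¬ (X.leaf u).IsPB) ⊔
      X.leafSpan (Finset.univ.filter fun u => (X.leaf u).IsPB) = ⊤ := by
  rw [sup_comm, leafSpan, leafSpan, ← Finset.iSup_union, Finset.filter_union_filter_not_eq]
  exact leafSpan_univ X

/-- the cost of `(N_atoms, blocks)` is `2 dim X` -/
theorem cost_atoms_blocks (X : Obj₂) :
    finrank ℚ (X.leafSpan (Finset.univ.filter fun u => ¬ (X.leaf u).IsPB)) +
      4 * (Finset.univ.filter fun u => (X.leaf u).IsPB).card ≤ 2 * X.dim := by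
  have h1 := finrank_leafSpan_le (X := X) (Finset.univ.filter fun u => ¬ (X.leaf u).IsPB)
  have h2 : ∑ u ∈ Finset.univ.filter (fun u => ¬ (X.leaf u).IsPB), finrank ℚ (X.leaf u).obj.L =
      ∑ u ∈ Finset.univ.filter (fun u => ¬ (X.leaf u).IsPB), 2 * (X.leaf u).pdim :=
    Finset.sum_congr rfl fun u hu => finrank_leaf_of_not_isPB _ (Finset.mem_filter.mp hu).2
  have h3 : 4 * (Finset.univ.filter fun u => (X.leaf u).IsPB).card =
      ∑ u ∈ Finset.univ.filter (fun u => (X.leaf u).IsPB), 2 * (X.leaf u).pdim := by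
    rw [Finset.card_eq_sum_ones, Finset.mul_sum]
    exact Finset.sum_congr rfl fun u hu => by rw [pdim_of_isPB (Finset.mem_filter.mp hu).2]; norm_num
  have h4 : ∑ u ∈ Finset.univ.filter (fun u => (X.leaf u).IsPB), 2 * (X.leaf u).pdim +
      ∑ u ∈ Finset.univ.filter (fun u => ¬ (X.leaf u).IsPB), 2 * (X.leaf u).pdim = 2 * X.dim := by
    rw [Finset.sum_filter_add_sum_filter_not, Obj₂.dim, Finset.mul_sum]
  omega

/-- one generator lies in `hsGen` -/
theorem extPow_le_hsGen {N : Submodule ℚ X.L} {T : Finset X.s.toType} (hN : X.toObj.IsSubHS N)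
    (hT : ∀ u ∈ T, (X.leaf u).IsPB) {c : ℕ} (hc : finrank ℚ N + 4 * T.card ≤ c) (l : ℕ) :
    extPow (N ⊔ X.leafSpan T) l ≤ X.hsGen c l :=
  le_iSup_of_le N (le_iSup_of_le T (le_iSup_of_le ⟨hN, hT, hc⟩ le_rfl))

/-! ### Pull-back of generators along a morphism `f : X ⟶ Y` (`f.lin : H¹(Y) → H¹(X)` block-admissible) -/

section Pull

variable {Y : Obj₂} (f : Hom₂ X Y)

open Classical in
/-- the Picard-block leaves of `X` onto which `f^*` maps the block leaf `u` of `Y` isomorphically (`∅` or a singleton) -/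
def admTgt (u : Y.s.toType) : Finset X.s.toType :=
  if h : ∃ u' : X.s.toType, (X.leaf u').IsPB ∧ ∃ g : (Y.leaf u).obj.L ≃ₗ[ℚ] (X.leaf u').obj.L,
      f.lin ∘ₗ Y.inclAt u = X.inclAt u' ∘ₗ g.toLinearMap then {h.choose} else ∅

/-- (Ported verbatim from the HodgeCMPerL package; no docstring in the source.) -/
theorem card_admTgt_le (u : Y.s.toType) : (admTgt f u).card ≤ 1 := by
  unfold admTgt
  split_ifs <;> simp

/-- (Ported verbatim from the HodgeCMPerL package; no docstring in the source.) -/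
theorem isPB_of_mem_admTgt {u : Y.s.toType} {u' : X.s.toType} (h : u' ∈ admTgt f u) : (X.leaf u').IsPB := by
  unfold admTgt at h
  split_ifs at h with hc
  · rw [Finset.mem_singleton] at h
    rw [h]
    exact hc.choose_spec.1
  · exact absurd h (Finset.notMem_empty _)

/-- `f^*` maps a block leaf of `Y` into the span of its target leaves -/
theorem range_comp_inclAt_le {u : Y.s.toType} (hu : (Y.leaf u).IsPB) :
    LinearMap.range (f.lin ∘ₗ Y.inclAt u) ≤ X.leafSpan (admTgt f u) := by
  rcases f.adm u hu with h0 | ⟨u', hu', g, hg, -⟩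
  · rw [h0, LinearMap.range_zero]
    exact bot_le
  · have hc : ∃ u' : X.s.toType, (X.leaf u').IsPB ∧ ∃ g : (Y.leaf u).obj.L ≃ₗ[ℚ] (X.leaf u').obj.L,
        f.lin ∘ₗ Y.inclAt u = X.inclAt u' ∘ₗ g.toLinearMap := ⟨u', hu', g, hg⟩
    obtain ⟨g₀, hg₀⟩ := hc.choose_spec.2
    have hmem : hc.choose ∈ admTgt f u := by
      unfold admTgt
      rw [dif_pos hc]
      exact Finset.mem_singleton_self _
    rw [hg₀]
    exact (LinearMap.range_comp_le_range _ _).trans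
      (le_iSup₂_of_le (f := fun u' (_ : u' ∈ admTgt f u) => LinearMap.range (X.inclAt u')) hc.choose hmem le_rfl)

/-- `f^*(L_T) ≤ L_{T'}` with `T'` the target leaves of `T` -/
theorem leafSpan_map_le (T : Finset Y.s.toType) (hT : ∀ u ∈ T, (Y.leaf u).IsPB) :
    (Y.leafSpan T).map f.lin ≤ X.leafSpan (T.biUnion (admTgt f)) := by
  unfold leafSpan
  rw [Submodule.map_iSup]
  refine iSup_le fun u => ?_
  rw [Submodule.map_iSup]
  refine iSup_le fun hu => ?_
  rw [← LinearMap.range_comp]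
  exact (range_comp_inclAt_le f (hT u hu)).trans (leafSpan_mono (Finset.subset_biUnion_of_mem (admTgt f) hu))

/-- (Ported verbatim from the HodgeCMPerL package; no docstring in the source.) -/
theorem card_biUnion_admTgt_le (T : Finset Y.s.toType) : (T.biUnion (admTgt f)).card ≤ T.card :=
  Finset.card_biUnion_le.trans (by
    rw [Finset.card_eq_sum_ones T]
    exact Finset.sum_le_sum fun u _ => card_admTgt_le f u)

/-- **the pull-back of one generator of `Y` is inside `hsGen X`** (same budget, same degree) -/
theorem map_extPow_gen_le {N : Submodule ℚ Y.L} {T : Finset Y.s.toType} (hN : Y.toObj.IsSubHS N)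
    (hT : ∀ u ∈ T, (Y.leaf u).IsPB) {c : ℕ} (hc : finrank ℚ N + 4 * T.card ≤ c) (l : ℕ) :
    (extPow (N ⊔ Y.leafSpan T) l).map (map l f.lin) ≤ X.hsGen c l := by
  refine (map_extPow_le _ _ _).trans ?_
  rw [Submodule.map_sup]
  refine (extPow_mono (sup_le_sup_left (leafSpan_map_le f T hT) _) l).trans ?_
  refine extPow_le_hsGen (hN.map f.hom) (fun u' hu' => ?_) ?_ l
  · obtain ⟨u, -, hu⟩ := Finset.mem_biUnion.mp hu'
    exact isPB_of_mem_admTgt f hu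
  · have h1 := Submodule.finrank_map_le f.lin N
    have h2 := card_biUnion_admTgt_le f T
    change finrank ℚ (N.map f.lin) + 4 * (T.biUnion (admTgt f)).card ≤ c
    omega

/-- **`f^*(hsGen Y) ≤ hsGen X`** -/
theorem hsGen_map_le (c l : ℕ) : (Y.hsGen c l).map (map l f.lin) ≤ X.hsGen c l := by
  rw [hsGen, Submodule.map_iSup]
  refine iSup_le fun N => ?_
  rw [Submodule.map_iSup]
  refine iSup_le fun T => ?_
  rw [Submodule.map_iSup]
  refine iSup_le fun h => ?_
  exact map_extPow_gen_le f h.1 h.2.1 h.2.2 l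

/-- **`f^*(⋀^l H¹(Y)) ≤ hsGen X c l`** for a `Y` with `2 dim Y ≤ c` -/
theorem top_map_le_hsGen {c : ℕ} (hY : 2 * Y.dim ≤ c) (l : ℕ) :
    (⊤ : Submodule ℚ (⋀[ℚ]^l Y.L)).map (map l f.lin) ≤ X.hsGen c l := by
  rw [← extPow_top, ← leafSpan_atoms_sup_blocks Y]
  exact map_extPow_gen_le f (isSubHS_leafSpan _) (fun u hu => (Finset.mem_filter.mp hu).2)
    ((cost_atoms_blocks Y).trans hY) l

end Pull

/-! ### The block contraction descends the generators -/

/-- **descent of `hsGen` under the block contraction**: for block-free `P`, Hodge maps `ψ₁ : H¹(P) → H¹(A)`,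
`ψ₂ : H¹(P) → H¹(B)` and `rk H¹(B) ≤ d`, the contraction `contr k d ψ₁ ψ₂ τ` maps `hsGen P c (k + d)` into
`hsGen A (c - d) k`. -/
theorem map_contr_hsGen_le {P A B : Obj₂} (hP : P.IsBlockFree) (ψ₁ : P.L →ₗ[ℚ] A.L) (ψ₂ : P.L →ₗ[ℚ] B.L)
    (hψ₁ : Obj.IsHodge (X := A.toObj) (Y := P.toObj) ψ₁) (hψ₂ : Obj.IsHodge (X := B.toObj) (Y := P.toObj) ψ₂)
    {d : ℕ} (τ : (⋀[ℚ]^d B.L) →ₗ[ℚ] ℚ) (hd : finrank ℚ B.L ≤ d) (c k : ℕ) :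
    (P.hsGen c (k + d)).map (contr k d ψ₁ ψ₂ τ) ≤ A.hsGen (c - d) k := by
  rw [hsGen, Submodule.map_iSup]
  refine iSup_le fun N => ?_
  rw [Submodule.map_iSup]
  refine iSup_le fun T => ?_
  rw [Submodule.map_iSup]
  refine iSup_le fun h => ?_
  obtain ⟨hN, hT, hc⟩ := h
  have hT0 : P.leafSpan T = ⊥ := by
    rw [leafSpan, eq_bot_iff]
    exact iSup₂_le fun u hu => absurd (hT u hu) (hP u)
  rw [hT0, sup_bot_eq]
  by_cases hlt : finrank ℚ N < finrank ℚ ↥(N ⊓ LinearMap.ker ψ₂) + d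
  · rw [map_contr_extPow_eq_bot ψ₁ ψ₂ τ N hlt]
    exact bot_le
  refine (map_contr_extPow_le ψ₁ ψ₂ τ N hd).trans ?_
  let f : Obj.Hom A.toObj P.toObj := ⟨ψ₁, hψ₁⟩
  let g : Obj.Hom B.toObj P.toObj := ⟨ψ₂, hψ₂⟩
  have hN₀ : A.toObj.IsSubHS ((N ⊓ LinearMap.ker ψ₂).map ψ₁) := (hN.inf (P.toObj.isSubHS_ker g)).map f
  refine (extPow_mono le_sup_left k).trans (extPow_le_hsGen (T := ∅) hN₀ (by simp) ?_ k)
  have h1 := Submodule.finrank_map_le ψ₁ (N ⊓ LinearMap.ker ψ₂)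
  rw [Finset.card_empty, mul_zero, add_zero]
  omega

/-! ### Rigidity of a primitive CM atom -/

/-- **`B^p(A_{(K,Φ)}) = 0`** outside the full regime for a PRIMITIVE CM type `Φ` of a Galois CM field `K` with
`2p + 4 < [K:ℚ]`: `H¹(A)` is a simple rational Hodge structure and `A` carries no block. -/
theorem hsGen_cmObj₂_eq_bot {K : CMField} [IsGalois ℚ K] {Φ : CMType K} (hprim : Primitive K Φ) {c l : ℕ}
    (hc : c < finrank ℚ K) (hl : 0 < l) : (cmObj₂ K Φ).hsGen c l = ⊥ := by
  rw [hsGen]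
  refine iSup_eq_bot.mpr fun N => iSup_eq_bot.mpr fun T => iSup_eq_bot.mpr fun h => ?_
  obtain ⟨hN, hT, hcost⟩ := h
  have hT0 : (cmObj₂ K Φ).leafSpan T = ⊥ := by
    rw [leafSpan, eq_bot_iff]
    exact iSup₂_le fun u hu => absurd (hT u hu) (isBlockFree_cmObj₂ K Φ u)
  have hL : finrank ℚ (cmObj₂ K Φ).L = finrank ℚ K := finrank_L_cmObj K Φ
  have hN0 : N = ⊥ := by
    rcases Obj.IsSubHS.eq_bot_or_eq_top (Obj.typ_injective_of_primitive hprim) hN with h0 | h1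
    · exact h0
    · exfalso
      rw [h1, _root_.finrank_top] at hcost
      omega
  rw [hN0, hT0, sup_bot_eq]
  exact extPow_bot_of_pos hl

end Obj₂

end HodgeCM.ToyG2

end
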